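import Summits.QuantumFields.BalabanUV.Beta.FP.PerfectSecondOrderTablesDressed
import Summits.QuantumFields.BalabanUV.Beta.FP.PerfectSecondOrderTablesTranslate
import Summits.QuantumFields.BalabanUV.Beta.FP.NestedDressingKernel
import Summits.QuantumFields.BalabanUV.Beta.FP.StepLawKHolds
import Summits.QuantumFields.BalabanUV.Beta.FP.SymmetryK

/-!
# `BalabanUV.Beta.FP.PerfectSecondOrderTablesNested` — road «FP» for binder row D1, RULING R-FP-45 (B)∕(E): THE INSTANCE LINES AT THE PIN OF RECORD — the class letter and
# the (Wt) row of the NESTED-DRESSED m-fold carrier `Π^{(m+1)}·WtInf G_nest … (m+1)·Π^{(m+1)ᵀ}` with the G-SLOT OF RECORD `G_nest n := Π^{(n)ᵀ}·KPerf n·Π^{(n)}` (the CO-DRESSED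
# perfect resolvent — OWNER WORD Q-FP-15-1 l.34163: «`coDress` by `piKSymNest (m+1)` of `KPerf (m+1)`, NOT the bare `KPerf (m+1)` and NOT a free `G`», the nested twin of
# the literal's `Gsym j = coDressKSymAt ρ_c Lc (KInvStep Lc j)`), at leaf-06's kernel `piKSymNest (toSite r) Lc n` (ROW NESTED-DRESS FILE 4 `NestedDressingKernel`); every
# projector letter is a THEOREM (`exists_decays_piKSymNest`, `shiftK_piKSymNest`; `StepLawKHolds.exists_decays_KPerf_holds`, `SymmetryK.shiftK_KPerf`)

HONEST DEPENDENCY (page 1, mandatory): continuum YM on T⁴ ⇐ BetaPertH ∧ nine spine estimates (0/9 proved); BetaPertH ⇐ (D1) ∧ (D4) ∧ CAP+tail;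
G-an2-4 gates asym, D1 and NE2/3/4.  HONEST FRAMING (cell contract, verbatim): «discharging `BetaPertH` makes Bałaban's UV stability UNCONDITIONAL —
a real constructive-QFT result; it is NOT the continuum limit and NOT the Clay problem.»  THIS MODULE DISCHARGES NOTHING of the wall: [folklore] instantiations BY NAME of FILE
`PerfectSecondOrderTablesDressed` ∕ `PerfectSecondOrderTablesTranslate` at leaf-06's kernel and the road's perfect resolvent.  No `def`, no `def … : Prop`, nothing cited, 0 sorry;
0 estimates of Bałaban's constrained objects; 0∕4 row-D1 binders; NOT X1m for the literal, NOT (CONV-C), NOT SDF, NOT D1, NOT BetaPertH, NOT continuum, NOT Clay.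

ABSOLUTE RULE (cell charter, verbatim): «No internally-minted statement may enter as a cited fact. Every hypothesis is either kernel-proved in this package or a
verbatim quotation of a PUBLISHED theorem with page reference. The manuscript(s) under audit are NOT citable for their own disputed steps — they are the thing
under adjudication; programme-internal (2001/route/tribunal) claims are never citable.»

THE G-SLOT OF RECORD (displayed, written inline — no new def): `G_nest r n := comp (comp (trK (piKSymNest (toSite r) Lc n)) (KPerf Lc (sfStep Lc) (smStep 3 Lc) n)) (piKSymNest (toSite r) Lc n)`
= `Π^{(n)ᵀ}·KPerf n·Π^{(n)}` in the cell's `comp`∕`trK` convention (an2's `coDressKSymAt` shape with `piKSymBm ↦ piKSymNest … n`; at `n = 1` it IS `coDressKSymAt` by leaf-06's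
`piKSymNest_one`).  The OUTER dressing of the two external legs is `P := piKSymNest (toSite r) Lc (m+1)` as in `dressSymAt_W`.  The m-fold COMPOSITE multiplier ∕ mixed tables
(`MCompInf`, `M2CompInf`, FILE D2) and the action stencils `S∞`, `S₂∞` fill the other slots (OWNER WORD l.33765 (a): (B) changes the dressing, not the carrier).

CONTENTS (in-block root `toSite r`, `r ∈ box 4 Lc`; `2 ≤ Lc`; dimension d = 3 where the perfect resolvent's letters live).
* §1 generic: `decays_coDress_piKSymNest` (`∃`-Decays of `Πᵀ·K·Π` from an `∃`-Decays letter of `K` — an2's `decays_coDressKSymAt` proof verbatim with `decays_piKSymNest`),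
  `shiftK_coDress` (shift invariance of `Pᵀ·K·P` from that of `P` and `K`).
* §2 the G-slot's letters: **`exists_decays_Gnest`**, **`shiftK_Gnest`** — THEOREMS (no hypothesis on the projector or the resolvent).
* §3 **`vertexFamily₂_nest_WtInf`** — `∃ Cw δw, 0 < δw ∧ VertexFamily₂ (Π·WtInf G_nest … (m+1)·Πᵀ) (Lc^(m+1)) Cw δw` from the fine-stencil letters ONLY;
  **`nest_WtInf_translate`** — its (Wt) row at blocking `Lc^(m+1)` from the block covariance of `S∞`, `S₂∞` ONLY.
Provenance: D1 formalisation swarm LEAF PROVER 02, unit b2b-balaban-beta-d1-formalise-leaf-02 gen 14, 2026-08-21; OWNER GO l.33765 (c) ∕ l.33918 (b) ∕ Q-FP-15-1 l.34163 (G-slot reading);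
leaf-06 naming W-d1leaf06g14-4 l.33880.
-/

noncomputable section

namespace Summit.QuantumFields.BalabanUV.Beta.FP.PerfectSecondOrderTablesNested

open Literature.MathematicalPhysics.QuantumFieldTheory.Balaban1983to89.Beta
open AffineAveraging (box toSite)
open ExpKernelCalculus (Site MKer Decays VertexFamily₂ comp shiftK comp_shiftK)
open OneStepResolventKernel (Fib LocStencil)
open BalabanCompositeJets (LocStencil₂)
open BalabanStepJetsSucc (decays_comp)
open Summit.QuantumFields.BalabanUV.Beta.TameKernelCalculus (trK decays_trK)
open Summit.QuantumFields.BalabanUV.Beta.SymmetrisedStepJets (SymTables)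
open Summit.QuantumFields.BalabanUV.Beta.GAN24.CombesThomas (sfStep smStep)
open Summit.QuantumFields.BalabanUV.Beta.FP.PerfectObjectsT (KPerf)
open Summit.QuantumFields.BalabanUV.Beta.FP.StepLawKHolds (exists_decays_KPerf_holds)
open Summit.QuantumFields.BalabanUV.Beta.FP.SymmetryK (shiftK_KPerf)
open Summit.QuantumFields.BalabanUV.Beta.FP.PerfectSecondOrderTablesInf (WtInf)
open Summit.QuantumFields.BalabanUV.Beta.FP.PerfectSecondOrderTablesDressed (vertexFamily₂_dress_WtInf)
open Summit.QuantumFields.BalabanUV.Beta.FP.PerfectSecondOrderTablesTranslate (dress_WtInf_translate)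
open Summit.QuantumFields.BalabanUV.Beta.FP.NestedDressingKernel (piKSymNest cPbNest decays_piKSymNest exists_decays_piKSymNest shiftK_piKSymNest)

/-! ## §1 Co-dressing by the nested kernel: decay and shift letters -/

section CoDress

variable {d : ℕ} {Lc : ℕ}

/-- [folklore] **THE CO-DRESSED KERNEL `Πᵀ·K·Π` DECAYS** (SOME rate) as soon as `K` does — an2's `SymmetrisedDressingKernel.decays_coDressKSymAt` with `piKSymBm ↦ piKSymNest … n`
(leaf-06's `decays_piKSymNest` at the two rates `δ`, `δ∕2`). -/
theorem decays_coDress_piKSymNest (hLc : 1 ≤ Lc) {r : Fin (d + 1) → ℕ} (hr : r ∈ box (d + 1) Lc) (n : ℕ)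
    {K : MKer (d + 1) (Fib d)} (hK : ∃ δ C : ℝ, 0 < δ ∧ 0 ≤ C ∧ Decays K C δ) :
    ∃ δ C : ℝ, 0 < δ ∧ 0 ≤ C ∧ Decays (comp (comp (trK (piKSymNest (toSite r) Lc n)) K) (piKSymNest (toSite r) Lc n)) C δ := by
  obtain ⟨δ, C, hδ, -, hK⟩ := hK
  have hPt : Decays (trK (piKSymNest (toSite r) Lc n)) (cPbNest d Lc n δ) δ := decays_trK (decays_piKSymNest hLc hr n hδ.le)
  have h1 := decays_comp hPt hK (show 0 ≤ δ / 2 by linarith) (show δ / 2 < δ by linarith)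
  have hP : Decays (piKSymNest (toSite r) Lc n) (cPbNest d Lc n (δ / 2)) (δ / 2) := decays_piKSymNest hLc hr n (by linarith)
  have h2 := decays_comp h1 hP (show 0 ≤ δ / 4 by linarith) (show δ / 4 < δ / 2 by linarith)
  exact ⟨δ / 4, _, by linarith, h2.nonneg (Sum.inl 0), h2⟩

/-- [folklore] Shift invariance of `Pᵀ·K·P` from that of `P` and `K`. -/
theorem shiftK_coDress {P K : MKer (d + 1) (Fib d)} {v : Site (d + 1)} (hP : shiftK v P = P) (hK : shiftK v K = K) :
    shiftK v (comp (comp (trK P) K) P) = comp (comp (trK P) K) P := by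
  rw [← comp_shiftK, ← comp_shiftK, hP, hK, show shiftK v (trK P) = trK (shiftK v P) from rfl, hP]

end CoDress

/-! ## §2 The G-slot of record and its two letters (theorems) -/

section GSlot

variable {Lc : ℕ} [NeZero Lc]

/-- [our object — bookkeeping] **THE CO-DRESSED PERFECT RESOLVENT DECAYS** (d = 3, `2 ≤ Lc`, every `n ≥ 1`; SOME rate): `StepLawKHolds.exists_decays_KPerf_holds` through §1. -/
theorem exists_decays_Gnest (hLc : 2 ≤ Lc) {r : Fin (3 + 1) → ℕ} (hr : r ∈ box (3 + 1) Lc) {n : ℕ} (hn : 1 ≤ n) :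
    ∃ δ C : ℝ, 0 < δ ∧ 0 ≤ C ∧
      Decays (comp (comp (trK (piKSymNest (toSite r) Lc n)) (KPerf (d := 3) Lc (sfStep Lc) (smStep 3 Lc) n)) (piKSymNest (toSite r) Lc n)) C δ := by
  obtain ⟨C, δ, hδ, hK⟩ := exists_decays_KPerf_holds hLc hn
  exact decays_coDress_piKSymNest (by omega) hr n ⟨δ, C, hδ, hK.nonneg (Sum.inl 0), hK⟩

/-- [our object — bookkeeping] **THE CO-DRESSED PERFECT RESOLVENT IS `Lc^n`-BLOCK-TRANSLATION INVARIANT** (any `d`, `1 ≤ Lc`, any root): `SymmetryK.shiftK_KPerf` + leaf-06's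
`shiftK_piKSymNest`. -/
theorem shiftK_Gnest {d : ℕ} (hLc : 1 ≤ Lc) (ρ : Fin (d + 1) → ℤ) (sf sm : ℕ → ℝ) (n : ℕ) (t : Site (d + 1)) :
    shiftK (-((((Lc ^ n : ℕ) : ℤ)) • t)) (comp (comp (trK (piKSymNest ρ Lc n)) (KPerf (d := d) Lc sf sm n)) (piKSymNest ρ Lc n))
      = comp (comp (trK (piKSymNest ρ Lc n)) (KPerf (d := d) Lc sf sm n)) (piKSymNest ρ Lc n) := by
  have hP : shiftK (-((((Lc ^ n : ℕ) : ℤ)) • t)) (piKSymNest ρ Lc n) = piKSymNest ρ Lc n := by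
    have h := shiftK_piKSymNest (d := d) ρ hLc n t
    push_cast
    exact h
  exact shiftK_coDress hP (shiftK_KPerf Lc sf sm n t)

end GSlot

/-! ## §3 The instance lines at the pin of record -/

section Instance

variable {Lc : ℕ} [NeZero Lc] (tabs : SymTables 3 Lc) (cΛ : ℝ)
  {Sinf : Fin (3 + 1) → Site (3 + 1) → MKer (3 + 1) (Fib 3)} {S₂inf : Fin (3 + 1) → Site (3 + 1) → Fin (3 + 1) → Site (3 + 1) → MKer (3 + 1) (Fib 3)}

/-- [our object — bookkeeping] **THE CLASS LETTER OF THE NESTED-DRESSED PIN AT THE G-SLOT OF RECORD**: for `2 ≤ Lc`, an in-block root `toSite r`, every `m`,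
`∃ Cw δw, 0 < δw ∧ VertexFamily₂ (fun μ y ν y′ ↦ Π·(WtInf G_nest tabs cΛ S∞ S₂∞ (m+1) μ y ν y′)·Πᵀ) (Lc^(m+1)) Cw δw`, `Π := piKSymNest (toSite r) Lc (m+1)`,
`G_nest n := Πₙᵀ·KPerf n·Πₙ` — from the fine-stencil letters `LocStencil S∞`, `LocStencil₂ S₂∞` ONLY (every projector ∕ resolvent ∕ composite-table letter is a theorem). -/
theorem vertexFamily₂_nest_WtInf (hLc : 2 ≤ Lc) {r : Fin (3 + 1) → ℕ} (hr : r ∈ box (3 + 1) Lc) (m : ℕ)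
    {Cs δs : ℝ} (hS : LocStencil Sinf Cs δs) (hδs : 0 < δs) {C₂ δ₂ : ℝ} (hS₂ : LocStencil₂ S₂inf C₂ δ₂) (hδ₂ : 0 < δ₂) :
    ∃ Cw δw : ℝ, 0 < δw ∧
      VertexFamily₂ (fun μ y ν y' => comp (comp (piKSymNest (toSite r) Lc (m + 1))
        (WtInf (fun n => comp (comp (trK (piKSymNest (toSite r) Lc n)) (KPerf (d := 3) Lc (sfStep Lc) (smStep 3 Lc) n)) (piKSymNest (toSite r) Lc n))
          tabs cΛ Sinf S₂inf (m + 1) μ y ν y'))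
        (trK (piKSymNest (toSite r) Lc (m + 1)))) (Lc ^ (m + 1)) Cw δw :=
  vertexFamily₂_dress_WtInf tabs cΛ (exists_decays_piKSymNest (by omega) hr (m + 1)) m (exists_decays_Gnest hLc hr (by omega)) hS hδs hS₂ hδ₂

/-- [our object — bookkeeping] **THE (Wt) ROW OF THE NESTED-DRESSED PIN AT THE G-SLOT OF RECORD** (blocking `Lc^(m+1)`, in-block root): from the block-translation covariance of
`S∞`, `S₂∞` ONLY — `dress_WtInf_translate` at `shiftK_piKSymNest` and `shiftK_Gnest`. -/
theorem nest_WtInf_translate (hLc : 1 ≤ Lc) (ρ : Fin (3 + 1) → ℤ) (m : ℕ)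
    (hS : ∀ (κ : Fin (3 + 1)) (u t : Site (3 + 1)),
      Sinf κ (u + (((Lc ^ (m + 1) : ℕ) : ℤ)) • t) = shiftK (-((((Lc ^ (m + 1) : ℕ) : ℤ)) • t)) (Sinf κ u))
    (hS₂ : ∀ (κ : Fin (3 + 1)) (u : Site (3 + 1)) (κ' : Fin (3 + 1)) (u' t : Site (3 + 1)),
      S₂inf κ (u + (((Lc ^ (m + 1) : ℕ) : ℤ)) • t) κ' (u' + (((Lc ^ (m + 1) : ℕ) : ℤ)) • t)
        = shiftK (-((((Lc ^ (m + 1) : ℕ) : ℤ)) • t)) (S₂inf κ u κ' u'))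
    (μ : Fin (3 + 1)) (y : Site (3 + 1)) (ν : Fin (3 + 1)) (y' t : Site (3 + 1)) :
    comp (comp (piKSymNest ρ Lc (m + 1))
        (WtInf (fun n => comp (comp (trK (piKSymNest ρ Lc n)) (KPerf (d := 3) Lc (sfStep Lc) (smStep 3 Lc) n)) (piKSymNest ρ Lc n))
          tabs cΛ Sinf S₂inf (m + 1) μ (y + t) ν (y' + t)))
      (trK (piKSymNest ρ Lc (m + 1)))
      = shiftK (-((((Lc ^ (m + 1) : ℕ) : ℤ)) • t))
          (comp (comp (piKSymNest ρ Lc (m + 1))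
            (WtInf (fun n => comp (comp (trK (piKSymNest ρ Lc n)) (KPerf (d := 3) Lc (sfStep Lc) (smStep 3 Lc) n)) (piKSymNest ρ Lc n))
              tabs cΛ Sinf S₂inf (m + 1) μ y ν y'))
          (trK (piKSymNest ρ Lc (m + 1)))) := by
  have hP : ∀ t : Site (3 + 1), shiftK (-((((Lc ^ (m + 1) : ℕ) : ℤ)) • t)) (piKSymNest ρ Lc (m + 1)) = piKSymNest ρ Lc (m + 1) := by
    intro t'
    have h := shiftK_piKSymNest (d := 3) ρ hLc (m + 1) t'
    push_cast
    exact h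
  exact dress_WtInf_translate tabs cΛ (m + 1) hP (fun t' => shiftK_Gnest hLc ρ (sfStep Lc) (smStep 3 Lc) (m + 1) t') hS hS₂ μ y ν y' t

end Instance

end Summit.QuantumFields.BalabanUV.Beta.FP.PerfectSecondOrderTablesNested

end
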